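import Mathlib
import Summits.ValiantsHypothesis.ValiantsHypothesis.Theorems.FifoMatchingNNNotVPSupportFnMatchings
import Summits.ValiantsHypothesis.ValiantsHypothesis.Theorems.FifoMatchingNNDivisionHardShadowDominated
import Literature.Computability.AlgebraicComplexity.NestFreeMatchingPoly
import HarnessLib

/-!
# Route FifoMatching — crux `NNDivisionHard` (stmt-ValiantsHypothesis-21181):
# COVER-TRANSPARENT cofactors are decided (the `NN`-side of the `F^k` class)

A cofactor `h ∈ ℝ≥0[x_(i,j)]` is *cover-transparent* if its Boolean shadow is implied by vertex
coverage: `SuppFn h A` for every arc set `A` touching every vertex of `[2n]`.  Since an arc set carrying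
a (nest-free) perfect matching touches every vertex (`covers_of_suppFn_NN`), cover-transparent cofactors
are DOMINATED in the sense of the landed Boolean-shadow domination rung
(`NNDivisionHard.ShadowDominated.nnDivisionHard_of_dominated`, ✓ p823553), hence decided:

* `nnDivisionHard_of_coverTransparent` — for every `c`, eventually in `n`, every cover-transparent `h` has
  `2^((log₂ n + c)^c) < L₊(NN_n · h) + L₊(h)`.

The explicit family this settles: the powers of the VERTEX-STAR PRODUCT
`F_n := Π_{v ∈ [2n]} (Σ_{e ∋ v} x_e)` times anything with a constant term,

* `nnDivisionHard_starProductPow` — for every `c`, eventually in `n`, for every `D` and every `g` with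
  `coeff 0 g ≠ 0`: `2^((log₂ n + c)^c) < L₊(NN_n · (F_n^D · g)) + L₊(F_n^D · g)`.

These cofactors are cheap (repeated squaring), window-dense, deep for large `D` and spread — members of
the residual class of ✓ p822526 — and they are the `NN`-analogue of the first cofactor class the
`per`-side rows machinery cannot touch (`Cruxes/ZeroOneTransfer/Disproof.lean`, `resists` §6: «row-homogeneous
on all rows, e.g. `F^k = (Π_i Σ_j x_ij)^k`», where for `per` the Boolean reduction is stuck at Razborov's
`n^{Ω(log n)}`); for `NN` the Boolean bound is a tree theorem (stub A, ✓ p821759), so the class is decided.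

Honest framing: an explicit decided sub-family of 21181's former residual; `NNDivisionHard`, `NNNotVP`
and `VP ≠ VNP` stay OPEN (NOT proved).  No definitions (the star forms are written inline), no named facts.
-/

noncomputable section

-- Sub = Summit single-conjunct layout: the duplicated namespace component is mandated by the tree.
set_option linter.dupNamespace false
set_option autoImplicit false

namespace Summit.ValiantsHypothesis.ValiantsHypothesis.Theorems.FifoMatching.NNDivisionHard.CoverTransparent

open MvPolynomial Finset Literature.Computability.AlgebraicComplexity
open scoped NNReal BigOperators Classical
open Summit.ValiantsHypothesis.ValiantsHypothesis.Theorems.FifoMatching.NNNotVP.DivisionSplit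
  (σ NN SuppFn suppFn_iff_eval_ne_zero suppFn_NN_iff)
open Summit.ValiantsHypothesis.ValiantsHypothesis.Theorems.FifoMatching.NNDivisionHard.ShadowDominated
  (suppFn_mul_iff nnDivisionHard_of_dominated)

/-! ### §1 Perfect matchings cover every vertex -/

/-- **An arc set carrying a nest-free perfect matching touches every vertex**: if `SuppFn NN_n A`
then every `v ∈ [2n]` is an endpoint of an arc of `A` (the arc `(v, M v)` or `(M v, v)` of the
matching, `M` a fixed-point-free involution). [folklore] -/
theorem covers_of_suppFn_NN {n : ℕ} {A : Finset (σ n)} (hA : SuppFn (NN n) A) (v : Fin (2 * n)) :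
    ∃ e ∈ A, e.1 = v ∨ e.2 = v := by
  obtain ⟨M, hM, hMA⟩ := (suppFn_NN_iff n A).1 hA
  obtain ⟨hP, -⟩ := mem_nestFreeMatchings.1 hM
  obtain ⟨hinv, hfpf⟩ := mem_perfectMatchings.1 hP
  rcases lt_or_gt_of_ne (hfpf v) with hlt | hgt
  · -- `M v < v`: the arc `(M v, v)` (as `M (M v) = v`)
    refine ⟨(M v, M (M v)), hMA (M v) (by rw [hinv]; exact hlt), Or.inr ?_⟩
    exact hinv v
  · -- `v < M v`: the arc `(v, M v)`
    exact ⟨(v, M v), hMA v hgt, Or.inl rfl⟩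

/-- **Cover-transparent cofactors are dominated**: if `SuppFn h A` whenever `A` touches every vertex,
then `SuppFn NN_n A → SuppFn h A` for every `A`. [folklore] -/
theorem dominated_of_coverTransparent {n : ℕ} {h : MvPolynomial (σ n) ℝ≥0}
    (hcov : ∀ A : Finset (σ n), (∀ v : Fin (2 * n), ∃ e ∈ A, e.1 = v ∨ e.2 = v) → SuppFn h A) :
    ∀ A : Finset (σ n), SuppFn (NN n) A → SuppFn h A :=
  fun A hA => hcov A (covers_of_suppFn_NN hA)

/-! ### §2 The rung for cover-transparent cofactors -/

/-- **`NNDivisionHard` for COVER-TRANSPARENT cofactors**: for every `c`, eventually in `n`, every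
`h ∈ ℝ≥0[x_(i,j)]` whose shadow is implied by vertex coverage has
`2^((log₂ n + c)^c) < L₊(NN_n · h) + L₊(h)` (domination rung, `T = ∅`). [folklore] -/
theorem nnDivisionHard_of_coverTransparent (c : ℕ) :
    ∃ n₀ : ℕ, ∀ n ≥ n₀, ∀ h : MvPolynomial (Fin (2 * n) × Fin (2 * n)) ℝ≥0,
      (∀ A : Finset (σ n), (∀ v : Fin (2 * n), ∃ e ∈ A, e.1 = v ∨ e.2 = v) → SuppFn h A) →
      2 ^ ((Nat.log 2 n + c) ^ c) < complexity (nestFreeMatchingPoly n ℝ≥0 * h) + complexity h := by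
  obtain ⟨n₀, hn₀⟩ := nnDivisionHard_of_dominated c
  exact ⟨n₀, fun n hn h hcov => hn₀ n hn h (dominated_of_coverTransparent hcov)⟩

/-! ### §3 The explicit family: powers of the vertex-star product -/

/-- The shadow of a finite product over `ℝ≥0` splits factorwise. [folklore] -/
theorem suppFn_prod_iff {τ ι : Type*} (s : Finset ι) (f : ι → MvPolynomial τ ℝ≥0) (A : Finset τ) :
    SuppFn (∏ i ∈ s, f i) A ↔ ∀ i ∈ s, SuppFn (f i) A := by
  rw [suppFn_iff_eval_ne_zero, map_prod, Finset.prod_ne_zero_iff]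
  refine forall₂_congr fun i _ => ?_
  rw [suppFn_iff_eval_ne_zero]

/-- The shadow of a power (`D ≥ 1` or not): `SuppFn f A → SuppFn (f ^ D) A`. [folklore] -/
theorem suppFn_pow_of_suppFn {τ : Type*} {f : MvPolynomial τ ℝ≥0} {A : Finset τ} (hf : SuppFn f A)
    (D : ℕ) : SuppFn (f ^ D) A := by
  rw [suppFn_iff_eval_ne_zero] at hf ⊢
  rw [map_pow]
  exact pow_ne_zero D hf

/-- The shadow of a sum of distinct variables: `SuppFn (Σ_{e ∈ S} x_e) A ↔ S ∩ A ≠ ∅`. [folklore] -/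
theorem suppFn_sum_X_iff {τ : Type*} (S A : Finset τ) :
    SuppFn (∑ e ∈ S, (X e : MvPolynomial τ ℝ≥0)) A ↔ ∃ e ∈ S, e ∈ A := by
  rw [suppFn_iff_eval_ne_zero, map_sum, Ne, Finset.sum_eq_zero_iff, not_forall]
  constructor
  · rintro ⟨e, he⟩
    rw [Classical.not_imp, eval_X] at he
    refine ⟨e, he.1, ?_⟩
    by_contra h
    exact he.2 (if_neg h)
  · rintro ⟨e, he, heA⟩
    refine ⟨e, ?_⟩
    rw [Classical.not_imp, eval_X, if_pos heA]
    exact ⟨he, one_ne_zero⟩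

/-- A polynomial with a nonzero constant term has the identically-true shadow. [folklore] -/
theorem suppFn_of_coeff_zero_ne_zero {τ : Type*} {g : MvPolynomial τ ℝ≥0} (hg : coeff 0 g ≠ 0)
    (A : Finset τ) : SuppFn g A :=
  ⟨0, mem_support_iff.2 hg, by simp⟩

/-- **The vertex-star product powers are cover-transparent**: for every `D` and every `g` with a
nonzero constant term, `F_n^D · g` (with `F_n = Π_v Σ_{e ∋ v} x_e`) has `SuppFn` at every arc set
touching every vertex. [folklore] -/
theorem coverTransparent_starProductPow {n : ℕ} (D : ℕ) {g : MvPolynomial (σ n) ℝ≥0}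
    (hg : coeff 0 g ≠ 0) :
    ∀ A : Finset (σ n), (∀ v : Fin (2 * n), ∃ e ∈ A, e.1 = v ∨ e.2 = v) →
      SuppFn ((∏ v : Fin (2 * n),
        ∑ e ∈ univ.filter (fun e : σ n => e.1 = v ∨ e.2 = v), (X e : MvPolynomial (σ n) ℝ≥0)) ^ D * g) A := by
  intro A hcov
  rw [suppFn_mul_iff]
  refine ⟨suppFn_pow_of_suppFn ?_ D, suppFn_of_coeff_zero_ne_zero hg A⟩
  rw [suppFn_prod_iff]
  intro v _
  rw [suppFn_sum_X_iff]
  obtain ⟨e, heA, hev⟩ := hcov v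
  exact ⟨e, mem_filter.2 ⟨mem_univ _, hev⟩, heA⟩

/-- **`NNDivisionHard` at the vertex-star product powers** (the `NN`-side of the `F^k` class): for
every `c`, eventually in `n`, for every `D` and every `g` with `coeff 0 g ≠ 0`,
`2^((log₂ n + c)^c) < L₊(NN_n · (F_n^D · g)) + L₊(F_n^D · g)`, `F_n = Π_{v ∈ [2n]} Σ_{e ∋ v} x_e`.
[folklore] -/
theorem nnDivisionHard_starProductPow (c : ℕ) :
    ∃ n₀ : ℕ, ∀ n ≥ n₀, ∀ D : ℕ, ∀ g : MvPolynomial (Fin (2 * n) × Fin (2 * n)) ℝ≥0, coeff 0 g ≠ 0 →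
      2 ^ ((Nat.log 2 n + c) ^ c) <
        complexity (nestFreeMatchingPoly n ℝ≥0 *
            ((∏ v : Fin (2 * n), ∑ e ∈ univ.filter (fun e : σ n => e.1 = v ∨ e.2 = v),
              (X e : MvPolynomial (σ n) ℝ≥0)) ^ D * g)) +
          complexity ((∏ v : Fin (2 * n), ∑ e ∈ univ.filter (fun e : σ n => e.1 = v ∨ e.2 = v),
              (X e : MvPolynomial (σ n) ℝ≥0)) ^ D * g) := by
  obtain ⟨n₀, hn₀⟩ := nnDivisionHard_of_coverTransparent c
  exact ⟨n₀, fun n hn D g hg => hn₀ n hn _ (coverTransparent_starProductPow D hg)⟩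

end Summit.ValiantsHypothesis.ValiantsHypothesis.Theorems.FifoMatching.NNDivisionHard.CoverTransparent

end
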